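import Summits.Langlands.Langlands.Theses.QuarterDeficit1951
import Literature.NumberTheory.GaloisRepresentations.ArtinReciprocityCharacterFiniteProofs
import Literature.NumberTheory.NumberFields.EisensteinRamificationIndex
import Literature.NumberTheory.NumberFields.InertiaGeneratesGalois
import Literature.NumberTheory.Automorphic.BCDTTheoremBWildAtThreeDet
import Literature.NumberTheory.GaloisRepresentations.DirichletCharacterOfGaloisCharacter
import Literature.NumberTheory.GaloisRepresentations.FrobeniusDensityTheorem

/-!
# Route `QuarterDeficit1951` — crux `IcosahedralSupply`: `5 ∣ #e₀(I_𝔓)` at `1951` for the Doud–Moore roots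

Auxiliary registered helper for the stub `stub_dmLocal1951` (line `Sketch`): for the five roots
`θ i ∈ ℤ̄` of the Doud–Moore quintic `f = x⁵ − x⁴ − 780x³ + 9911x² − 24208x + 15952` and the
permutation representation `e₀` of `Γ_ℚ` on them, the image `e₀(I_𝔓)` of every inertia group
above `1951` has order divisible by `5`.  Proof: in the Galois number field
`L = ℚ(θ₀, …, θ₄) ⊆ ℚ̄` the elements `βᵢ = θᵢ + 390 ∈ 𝓞 L` satisfy `βᵢ⁵ ∈ 1951·𝓞 L` and
`∏ βᵢ = 1951 · 4611875228` (`f(x − 390)` is Eisenstein at `1951`), so `5 ∣ e(Q | 1951)` for the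
prime `Q = 𝔓 ∩ 𝓞 L` (`Literature.NumberTheory.NumberFields.dvd_ramificationIdx_of_pow_mem_of_prod_eq`),
`e(Q | 1951) = #I(Q)` (Galois), `I(Q)` is the restriction of `I_𝔓` (Serre I §7 Prop. 22 (b),
`exists_mem_inertia_absRestrictNormalHom_eq`), and `e₀` factors injectively through `Gal(L/ℚ)`.
-/

set_option linter.dupNamespace false

noncomputable section

open scoped NumberField
open Field IsDedekindDomain Polynomial
open Literature.NumberTheory.GaloisRepresentations

namespace Summit.Langlands.Langlands.Theorems.QuarterDeficit1951

/-- The Doud–Moore quintic over `ℚ`: degree `5`, and its value under `aeval`. [folklore] -/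
theorem dm_natDegree_aeval :
    (X ^ 5 - X ^ 4 - 780 * X ^ 3 + 9911 * X ^ 2 - 24208 * X + 15952 : ℚ[X]).natDegree = 5 ∧
    ∀ {A : Type*} [CommRing A] [Algebra ℚ A] (x : A),
      aeval x (X ^ 5 - X ^ 4 - 780 * X ^ 3 + 9911 * X ^ 2 - 24208 * X + 15952 : ℚ[X]) =
        x ^ 5 - x ^ 4 - 780 * x ^ 3 + 9911 * x ^ 2 - 24208 * x + 15952 := by
  refine ⟨by compute_degree!, fun x => ?_⟩
  simp only [map_add, map_sub, map_mul, map_pow, aeval_X, map_ofNat]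

/-- **Vieta for the Doud–Moore quintic, shifted by `390`.**  If five pairwise distinct elements
`t i` of a field of characteristic zero are roots of `f`, then `∏ (t i + 390) = 8997768569828`
(`= -f(-390)`; `f = ∏ (X - t i)`). [folklore] -/
theorem dm_prod_add_390 {K : Type*} [Field K] [CharZero K] (t : Fin 5 → K)
    (ht : ∀ i, t i ^ 5 - t i ^ 4 - 780 * t i ^ 3 + 9911 * t i ^ 2 - 24208 * t i + 15952 = 0)
    (hinj : Function.Injective t) : ∏ i, (t i + 390) = 8997768569828 := by
  classical
  letI : Algebra ℚ K := (Rat.castHom K).toAlgebra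
  set F : ℚ[X] := X ^ 5 - X ^ 4 - 780 * X ^ 3 + 9911 * X ^ 2 - 24208 * X + 15952 with hF
  obtain ⟨hdeg, heval⟩ := dm_natDegree_aeval
  set P : K[X] := F.map (algebraMap ℚ K) with hP
  have hPmonic : P.Monic := by
    have : F.Monic := by rw [hF]; monicity!
    exact this.map _
  have hPdeg : P.natDegree = 5 := by rw [hP, natDegree_map, hdeg]
  have hP0 : P ≠ 0 := hPmonic.ne_zero
  have hroots : ∀ i, t i ∈ P.roots := by
    intro i
    rw [mem_roots hP0, IsRoot.def, hP, eval_map, ← aeval_def, heval]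
    exact ht i
  -- the roots of `P` are exactly the `t i`
  have hsub : (Finset.univ.image t).val ≤ P.roots := by
    rw [Multiset.le_iff_subset (Finset.univ.image t).nodup]
    intro x hx
    rw [Finset.mem_val, Finset.mem_image] at hx
    obtain ⟨i, -, rfl⟩ := hx
    exact hroots i
  have hcard5 : (Finset.univ.image t).card = 5 := by
    rw [Finset.card_image_of_injective _ hinj, Finset.card_univ, Fintype.card_fin]
  have hcardroots : P.roots.card = 5 := by
    apply le_antisymm
    · exact hPdeg ▸ P.card_roots'
    · calc 5 = (Finset.univ.image t).card := hcard5.symm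
        _ = Multiset.card (Finset.univ.image t).val := rfl
        _ ≤ Multiset.card P.roots := Multiset.card_le_card hsub
  have hrootseq : P.roots = (Finset.univ.image t).val :=
    (Multiset.eq_of_le_of_card_le hsub (by rw [hcardroots]; exact hcard5.symm.le)).symm
  have hprod : P = (P.roots.map fun a => X - C a).prod :=
    (prod_multiset_X_sub_C_of_monic_of_roots_card_eq hPmonic (by rw [hcardroots, hPdeg])).symm
  -- evaluate at `-390`
  have hev : P.eval (-390) = ∏ x ∈ Finset.univ.image t, (-390 - x) := by
    conv_lhs => rw [hprod]
    rw [eval_multiset_prod, Multiset.map_map, hrootseq, Finset.prod_eq_multiset_prod]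
    congr 1
    refine Multiset.map_congr rfl fun x _ => ?_
    simp only [Function.comp_apply, eval_sub, eval_X, eval_C]
  rw [Finset.prod_image fun x _ y _ h => hinj h] at hev
  have hev' : P.eval (-390) = -8997768569828 := by
    rw [hP, eval_map, ← aeval_def, heval]; norm_num
  rw [Fin.prod_univ_five] at hev ⊢
  linear_combination (-1 : K) * (hev.symm.trans hev')

/-- **`5 ∣ #e₀(I_𝔓)` above `1951`.**  For the five roots of the Doud–Moore quintic in `ℤ̄` and
the permutation representation `e₀` of `Γ_ℚ` on them, the image of every inertia group above
`1951` has order divisible by `5` (Eisenstein at `1951`: valuation count in `𝓞 L`,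
`L = ℚ(θ₀,…,θ₄)`). [cite: DoudMoore2006, §2 and §4] -/
theorem dmLocal1951_five_dvd_card_inertia_map (θ : Fin 5 → absIntegers (𝓞 ℚ) ℚ)
    (hroot : ∀ i, θ i ^ 5 - θ i ^ 4 - 780 * θ i ^ 3 + 9911 * θ i ^ 2 - 24208 * θ i + 15952 = 0)
    (hinj : Function.Injective θ)
    (hall : ∀ x : AlgebraicClosure ℚ, x ^ 5 - x ^ 4 - 780 * x ^ 3 + 9911 * x ^ 2 - 24208 * x + 15952 = 0 →
      ∃ i, x = θ i)
    (e₀ : absoluteGaloisGroup ℚ →* Equiv.Perm (Fin 5))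
    (he₀ : ∀ (σ : absoluteGaloisGroup ℚ) (i : Fin 5), σ • θ i = θ (e₀ σ i)) :
    ∀ v : HeightOneSpectrum (𝓞 ℚ), v.residueCard = 1951 → ∀ 𝔓 ∈ v.primesAbove,
      5 ∣ Nat.card ((𝔓.inertia (absoluteGaloisGroup ℚ)).map e₀) := by
  classical
  intro v hv 𝔓 h𝔓
  -- pin the `ℚ`-algebra structures carried by the generic-`K` tree lemmas (not `toRatAlgebra`)
  letI algQQbar : Algebra ℚ (AlgebraicClosure ℚ) :=
    @AlgebraicClosure.instAlgebra ℚ _ ℚ _ (Algebra.id ℚ)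
  haveI : 𝔓.IsPrime := h𝔓.1
  have hp : Nat.Prime 1951 := by norm_num
  have hv' : ((1951 : ℕ) : 𝓞 ℚ) ∈ v.asIdeal := by
    have h1 : v = (Rat.HeightOneSpectrum.primesEquiv (R := 𝓞 ℚ)).symm ⟨1951, hp⟩ := by
      rw [Equiv.eq_symm_apply]
      exact Subtype.ext ((FramedRep.residueCard_eq_coe_primesEquiv' v).symm.trans hv)
    exact (Literature.NumberTheory.EllipticCurves.natCast_mem_asIdeal_iff_eq_primesEquiv_symm v hp).mpr
      h1
  -- the polynomial and its roots in `ℚ̄`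
  set F : ℚ[X] := X ^ 5 - X ^ 4 - 780 * X ^ 3 + 9911 * X ^ 2 - 24208 * X + 15952 with hF
  obtain ⟨hdeg, heval⟩ := dm_natDegree_aeval
  have hF0 : F ≠ 0 := by
    have hmonic : F.Monic := by rw [hF]; monicity!
    exact hmonic.ne_zero
  have hrootθ : ∀ i, ((θ i : absIntegers (𝓞 ℚ) ℚ) : AlgebraicClosure ℚ) ∈
      F.rootSet (AlgebraicClosure ℚ) := by
    intro i
    rw [mem_rootSet, heval]
    refine ⟨hF0, ?_⟩
    have h := congrArg (fun x : absIntegers (𝓞 ℚ) ℚ => (x : AlgebraicClosure ℚ)) (hroot i)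
    push_cast at h
    exact h
  -- the Galois number field `L = ℚ(roots) ⊆ ℚ̄`
  set L : IntermediateField ℚ (AlgebraicClosure ℚ) :=
    IntermediateField.adjoin ℚ (F.rootSet (AlgebraicClosure ℚ)) with hL
  letI algQL : Algebra ℚ L := IntermediateField.algebra' L
  haveI : Finite (F.rootSet (AlgebraicClosure ℚ)) := (rootSet_finite F _).to_subtype
  haveI hLfd : FiniteDimensional ℚ L :=
    IntermediateField.finiteDimensional_adjoin fun x hx => (isAlgebraic_of_mem_rootSet hx).isIntegral
  have hsplit : (F.map (algebraMap ℚ (AlgebraicClosure ℚ))).Splits := IsAlgClosed.splits _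
  haveI hLnormal : Normal ℚ L :=
    Normal.of_isSplittingField F (hFEp := IntermediateField.adjoin_rootSet_isSplittingField hsplit)
  haveI : NumberField L := ⟨⟩
  haveI : IsGalois ℚ L := ⟨⟩
  have hθL : ∀ i, ((θ i : absIntegers (𝓞 ℚ) ℚ) : AlgebraicClosure ℚ) ∈ L := fun i =>
    IntermediateField.subset_adjoin ℚ _ (hrootθ i)
  -- restriction to `L` and the factorisation `e₀ = ē ∘ res`
  set res : absoluteGaloisGroup ℚ →* (L ≃ₐ[ℚ] L) := absRestrictNormalHom (K := ℚ) L with hres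
  have hres_apply : ∀ (σ : absoluteGaloisGroup ℚ) (x : L),
      ((res σ x : L) : AlgebraicClosure ℚ) = σ • (x : AlgebraicClosure ℚ) := by
    intro σ x
    exact AlgEquiv.restrictNormalHom_apply L (absoluteGaloisGroup.toAlgEquiv ℚ σ) x
  have hsurj : Function.Surjective res :=
    (AlgEquiv.restrictNormalHom_surjective (F := ℚ) (K₁ := L) (AlgebraicClosure ℚ)).comp
      (absoluteGaloisGroup.toAlgEquiv ℚ).surjective
  -- `σ` fixes every root iff `e₀ σ = 1`
  have he₀_one : ∀ σ : absoluteGaloisGroup ℚ, (∀ i, σ • θ i = θ i) ↔ e₀ σ = 1 := by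
    intro σ
    constructor
    · intro h
      ext i
      exact congrArg Fin.val (hinj ((he₀ σ i).symm.trans (h i)))
    · intro h i
      rw [he₀ σ i, h, Equiv.Perm.coe_one, id]
  -- an element fixing the roots fixes `L` pointwise
  have hfixL : ∀ σ : absoluteGaloisGroup ℚ, (∀ i, σ • θ i = θ i) →
      ∀ x : AlgebraicClosure ℚ, x ∈ L → σ • x = x := by
    intro σ hfix x hx
    have hle : L ≤ IntermediateField.fixedField
        (Subgroup.zpowers (absoluteGaloisGroup.toAlgEquiv ℚ σ)) := by
      rw [hL, IntermediateField.adjoin_le_iff]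
      intro y hy
      refine (IntermediateField.mem_fixedField_iff _ _).mpr fun f hf => ?_
      obtain ⟨i, rfl⟩ : ∃ i, y = ((θ i : absIntegers (𝓞 ℚ) ℚ) : AlgebraicClosure ℚ) := by
        rw [mem_rootSet, heval] at hy
        exact hall y hy.2
      have h1 : absoluteGaloisGroup.toAlgEquiv ℚ σ ∈ MulAction.stabilizer
          (AlgebraicClosure ℚ ≃ₐ[ℚ] AlgebraicClosure ℚ)
          ((θ i : absIntegers (𝓞 ℚ) ℚ) : AlgebraicClosure ℚ) := by
        refine MulAction.mem_stabilizer_iff.mpr ?_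
        have := congrArg (fun x : absIntegers (𝓞 ℚ) ℚ => (x : AlgebraicClosure ℚ)) (hfix i)
        rw [integralClosure.coe_smul] at this
        exact this
      have hf' := MulAction.mem_stabilizer_iff.mp ((Subgroup.zpowers_le.mpr h1) hf)
      exact hf'
    have hx' := (IntermediateField.mem_fixedField_iff _ _).mp (hle hx) _ (Subgroup.mem_zpowers _)
    exact hx'
  have hkerle : res.ker ≤ e₀.ker := by
    intro σ hσ
    rw [MonoidHom.mem_ker] at hσ ⊢
    refine (he₀_one σ).mp fun i => Subtype.ext ?_
    have h := hres_apply σ ⟨_, hθL i⟩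
    rw [hσ, AlgEquiv.one_apply] at h
    rw [integralClosure.coe_smul]
    exact h.symm
  set ē : (L ≃ₐ[ℚ] L) →* Equiv.Perm (Fin 5) :=
    MonoidHom.liftOfSurjective res hsurj ⟨e₀, hkerle⟩ with hē
  have hē_apply : ∀ σ : absoluteGaloisGroup ℚ, ē (res σ) = e₀ σ := fun σ =>
    MonoidHom.liftOfRightInverse_comp_apply res _ _ ⟨e₀, hkerle⟩ σ
  have hē_inj : Function.Injective ē := by
    rw [← MonoidHom.ker_eq_bot_iff, eq_bot_iff]
    intro g hg
    rw [MonoidHom.mem_ker] at hg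
    obtain ⟨σ, rfl⟩ := hsurj g
    rw [hē_apply] at hg
    have hfix : ∀ i, σ • θ i = θ i := (he₀_one σ).mpr hg
    rw [Subgroup.mem_bot]
    refine AlgEquiv.ext fun x => Subtype.ext ?_
    rw [hres_apply, AlgEquiv.one_apply]
    exact hfixL σ hfix x x.2
  -- `(I_𝔓).map e₀ = ((I_𝔓).map res).map ē`, same cardinality as `(I_𝔓).map res`
  have hmapmap : (𝔓.inertia (absoluteGaloisGroup ℚ)).map e₀ =
      ((𝔓.inertia (absoluteGaloisGroup ℚ)).map res).map ē := by
    have hcomp : e₀ = ē.comp res := MonoidHom.ext fun σ => (hē_apply σ).symm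
    rw [Subgroup.map_map, ← hcomp]
  rw [hmapmap, Subgroup.card_map_of_injective hē_inj]
  -- the prime `Q = 𝔓 ∩ 𝓞 L` of `𝓞 L` over `1951`
  set ι := Literature.NumberTheory.EllipticCurves.ringOfIntegersToIntegralClosure (k := ℚ)
    (Ω := AlgebraicClosure ℚ) L with hιdef
  set Q : Ideal (𝓞 L) := 𝔓.comap ι with hQdef
  have hQover := comap_ringOfIntegersToIntegralClosure_mem_primesOver_of_mem_primesAbove L h𝔓
  haveI hQprime : Q.IsPrime := hQover.1
  haveI : Q.LiesOver v.asIdeal := hQover.2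
  have hQne : Q ≠ ⊥ := Ideal.ne_bot_of_liesOver_of_ne_bot v.ne_bot Q
  haveI hQmax : Q.IsMaximal := hQprime.isMaximal hQne
  -- `I(Q) ≤ (I_𝔓).map res` (inertia surjects onto inertia, Serre I §7 Prop. 22 (b))
  have hIle : Q.inertia (L ≃ₐ[ℚ] L) ≤ (𝔓.inertia (absoluteGaloisGroup ℚ)).map res := by
    intro g hgI
    -- `g` is an inertia element for the action on `integralClosure (𝓞 ℚ) L` at `𝔓 ∩ L`
    have hg' : (g : L ≃ₐ[ℚ] L) ∈
        (𝔓.comap (L.integralClosureToAbsIntegers (𝓞 ℚ))).inertia (L ≃ₐ[ℚ] L) := by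
      haveI : @IsScalarTower ℤ (𝓞 ℚ) L Algebra.toSMul Algebra.toSMul Algebra.toSMul :=
        IsScalarTower.of_algebraMap_eq' (RingHom.ext_int _ _)
      intro x
      have hxint : IsIntegral ℤ (x : L) := isIntegral_trans (R := ℤ) (A := 𝓞 ℚ) (x : L) x.2
      set y : 𝓞 L := ⟨(x : L), hxint⟩ with hydef
      have hy : g • y - y ∈ Q := hgI y
      rw [hQdef, Ideal.mem_comap] at hy
      change L.integralClosureToAbsIntegers (𝓞 ℚ) (g • x - x) ∈ 𝔓
      have heq : L.integralClosureToAbsIntegers (𝓞 ℚ) (g • x - x) = ι (g • y - y) := by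
        apply Subtype.ext
        rw [map_sub, map_sub]
        change ((L.integralClosureToAbsIntegers (𝓞 ℚ) (g • x) : absIntegers (𝓞 ℚ) ℚ) :
            AlgebraicClosure ℚ) - (L.integralClosureToAbsIntegers (𝓞 ℚ) x : AlgebraicClosure ℚ) =
          ((ι (g • y) : absIntegers (𝓞 ℚ) ℚ) : AlgebraicClosure ℚ) - (ι y : AlgebraicClosure ℚ)
        rw [IntermediateField.coe_integralClosureInclusion,
          IntermediateField.coe_integralClosureInclusion, hιdef,
          Literature.NumberTheory.EllipticCurves.coe_ringOfIntegersToIntegralClosure,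
          Literature.NumberTheory.EllipticCurves.coe_ringOfIntegersToIntegralClosure,
          integralClosure.coe_smul, RingOfIntegers.coe_galois_smul]
        rfl
      rw [heq]
      exact hy
    obtain ⟨σ, hσI, hσg⟩ := exists_mem_inertia_absRestrictNormalHom_eq 𝔓 L hg'
    exact ⟨σ, hσI, hσg⟩
  -- `5 ∣ #I(Q) = e(Q | 1951)` by the Eisenstein count
  haveI : IsScalarTower (𝓞 ℚ) ℚ L := IsScalarTower.of_algebraMap_eq' rfl
  haveI : IsGaloisGroup (L ≃ₐ[ℚ] L) (𝓞 ℚ) (𝓞 L) := IsGaloisGroup.of_isFractionRing _ _ _ ℚ L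
  have hdvdQ : 5 ∣ Nat.card (Q.inertia (L ≃ₐ[ℚ] L)) := by
    rw [Ideal.card_inertia_eq_ramificationIdxIn (G := L ≃ₐ[ℚ] L) v.asIdeal Q,
      Ideal.ramificationIdxIn_eq_ramificationIdx v.asIdeal Q (L ≃ₐ[ℚ] L)]
    -- `e(Q | 𝓞 ℚ) = e(Q | ℤ)`: both count `Q` in the factorisation of `1951 · 𝓞 L`
    have hnat : Rat.HeightOneSpectrum.natGenerator v = 1951 := by
      rw [← Rat.residueCard_eq_natGenerator]; exact hv
    have hspanL : Ideal.span {((1951 : ℕ) : 𝓞 L)} ≠ ⊥ := by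
      rw [Ne, Ideal.span_singleton_eq_bot]; exact_mod_cast hp.ne_zero
    have hmapO : Ideal.map (algebraMap (𝓞 ℚ) (𝓞 L)) v.asIdeal = Ideal.span {((1951 : ℕ) : 𝓞 L)} := by
      rw [Rat.asIdeal_eq_span_natGenerator, hnat, Ideal.map_span, Set.image_singleton, map_natCast]
    have hmapZ : Ideal.map (algebraMap ℤ (𝓞 L)) (Ideal.span {((1951 : ℕ) : ℤ)}) =
        Ideal.span {((1951 : ℕ) : 𝓞 L)} := by
      rw [Ideal.map_span, Set.image_singleton, map_natCast]
    have hpQ0 : ((1951 : ℕ) : 𝓞 L) ∈ Q := by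
      have h1 : ((1951 : ℕ) : 𝓞 ℚ) ∈ Q.under (𝓞 ℚ) := by rw [← hQover.2.over]; exact hv'
      rw [Ideal.under_def, Ideal.mem_comap, map_natCast] at h1
      exact h1
    haveI hoverZ : Q.LiesOver (Ideal.span {((1951 : ℕ) : ℤ)}) := by
      refine ⟨?_⟩
      have hprime : (Ideal.span {((1951 : ℕ) : ℤ)}).IsPrime :=
        (Ideal.span_singleton_prime (by exact_mod_cast hp.ne_zero)).mpr
          (Nat.prime_iff_prime_int.mp hp)
      have hmax : (Ideal.span {((1951 : ℕ) : ℤ)}).IsMaximal := hprime.isMaximal (by simp)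
      refine hmax.eq_of_le (Ideal.IsPrime.ne_top inferInstance) ?_
      rw [Ideal.span_le, Set.singleton_subset_iff, SetLike.mem_coe, Ideal.under_def, Ideal.mem_comap,
        map_natCast]
      exact hpQ0
    have e1 : Q.ramificationIdx ℤ =
        Multiset.count Q (UniqueFactorizationMonoid.normalizedFactors (Ideal.span {((1951 : ℕ) : 𝓞 L)})) := by
      rw [Ideal.IsDedekindDomain.ramificationIdx_eq_normalizedFactors_count (Ideal.span {((1951 : ℕ) : ℤ)}) Q
        (by rw [hmapZ]; exact hspanL), hmapZ]
    have e2 : Q.ramificationIdx (𝓞 ℚ) =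
        Multiset.count Q (UniqueFactorizationMonoid.normalizedFactors (Ideal.span {((1951 : ℕ) : 𝓞 L)})) := by
      rw [Ideal.IsDedekindDomain.ramificationIdx_eq_normalizedFactors_count v.asIdeal Q
        (by rw [hmapO]; exact hspanL), hmapO]
    rw [e2, ← e1]
    -- the roots as elements of `L`, integral over `ℤ`
    set θL : Fin 5 → L := fun i => ⟨((θ i : absIntegers (𝓞 ℚ) ℚ) : AlgebraicClosure ℚ), hθL i⟩
      with hθLdef
    haveI : @IsScalarTower ℤ (𝓞 ℚ) (AlgebraicClosure ℚ) Algebra.toSMul Algebra.toSMul Algebra.toSMul :=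
      IsScalarTower.of_algebraMap_eq' (RingHom.ext_int _ _)
    have hθint : ∀ i, IsIntegral ℤ (θL i) := by
      intro i
      have h1 : IsIntegral ℤ ((θ i : absIntegers (𝓞 ℚ) ℚ) : AlgebraicClosure ℚ) :=
        isIntegral_trans (R := ℤ) (A := 𝓞 ℚ) _ (θ i).2
      exact (isIntegral_algHom_iff (IsScalarTower.toAlgHom ℤ L (AlgebraicClosure ℚ))
        (algebraMap L (AlgebraicClosure ℚ)).injective).mp h1
    have hθLroot : ∀ i, θL i ^ 5 - θL i ^ 4 - 780 * θL i ^ 3 + 9911 * θL i ^ 2 - 24208 * θL i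
        + 15952 = 0 := by
      intro i
      apply (algebraMap L (AlgebraicClosure ℚ)).injective
      have h := congrArg (fun x : absIntegers (𝓞 ℚ) ℚ => (x : AlgebraicClosure ℚ)) (hroot i)
      push_cast at h
      simp only [map_sub, map_add, map_mul, map_pow, map_ofNat, map_zero]
      exact h
    have hθLinj : Function.Injective θL := by
      intro i j h
      apply hinj
      apply Subtype.ext
      exact congrArg (fun x : L => (x : AlgebraicClosure ℚ)) h
    -- `β i = θ i + 390 ∈ 𝓞 L`
    set b : Fin 5 → 𝓞 L := fun i => ⟨θL i, hθint i⟩ with hbdef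
    have hbcoe : ∀ i, algebraMap (𝓞 L) L (b i) = θL i := fun i => rfl
    have hOroot : ∀ i, b i ^ 5 - b i ^ 4 - 780 * b i ^ 3 + 9911 * b i ^ 2 - 24208 * b i
        + 15952 = 0 := by
      intro i
      apply NumberField.RingOfIntegers.coe_injective
      simp only [map_sub, map_add, map_mul, map_pow, map_ofNat, map_zero, hbcoe]
      exact hθLroot i
    have key : ∀ i, (b i + 390) ^ 5 = ((1951 : ℕ) : 𝓞 L) * ((b i + 390) ^ 4
        - 780 * (b i + 390) ^ 3 + 304039 * (b i + 390) ^ 2 - 59223812 * (b i + 390)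
        + 4611875228) := by
      intro i
      rw [Nat.cast_ofNat]
      linear_combination hOroot i
    set β : Fin 5 → 𝓞 L := fun i => b i + 390 with hβdef
    have hβcoe : ∀ i, ((β i : 𝓞 L) : L) = θL i + 390 := fun i => by
      simp only [hβdef, map_add, map_ofNat, hbcoe]
    have hpow : ∀ i, ∃ c : 𝓞 L, β i ^ 5 = (1951 : ℕ) * c := fun i => ⟨_, key i⟩
    have hprodL : ∏ i, (θL i + 390) = 8997768569828 := dm_prod_add_390 θL hθLroot hθLinj
    have hprod : ∏ i, β i = (1951 : ℕ) * (4611875228 : 𝓞 L) := by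
      apply NumberField.RingOfIntegers.coe_injective
      rw [map_prod]
      simp only [hβcoe, hprodL, map_mul, map_natCast, map_ofNat]
      norm_num
    have hpQ : ((1951 : ℕ) : 𝓞 L) ∈ Q := hpQ0
    have hu : (4611875228 : 𝓞 L) ∉ Q := by
      intro hu
      apply hQprime.ne_top
      rw [Ideal.eq_top_iff_one]
      have hbez : (1 : 𝓞 L) = (-1345031781 : 𝓞 L) * ((1951 : ℕ) : 𝓞 L) + 569 * 4611875228 := by
        push_cast; norm_num
      rw [hbez]
      exact Q.add_mem (Q.mul_mem_left _ hpQ) (Q.mul_mem_left _ hu)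
    exact Literature.NumberTheory.NumberFields.dvd_ramificationIdx_of_pow_mem_of_prod_eq
      hp hpQ β hpow hu hprod
  exact hdvdQ.trans (Subgroup.card_dvd_of_le hIle)

end Summit.Langlands.Langlands.Theorems.QuarterDeficit1951

end
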